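import Summits.KontsevichZagierPeriods.KontsevichZagierPeriods.Theorems.RootDecompWalshStrataConicClass
import Summits.KontsevichZagierPeriods.KontsevichZagierPeriods.Theorems.RootDecompWalshStrataPolarChart05

/-! # Root decomposition & Walsh strata — the conic-wall terminal, part 2: the branch and the height
integrand (gen 8, §36.4–36.5)

Route `RootDecompWalshStrata`, leaf `QuadricBakerDescent` (stmt-27597), residual kind hW, E-type
(residual R-E2 of NODE.md, decomp-kz-lens-4). Part 1 (`…ConicClass`) put the integrand `(γ/3)·|Λ³(l₀Λ −
c)|/(√δ(Λ² − c))` in `InBaker`; this part identifies it with the HEIGHT INTEGRAND `pheight` of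
`InBaker.psection_height` along a branch `X = X_ε(Y) = (l₁L + ε√δ)/k` (`ε = ±1`) of an adapted conic
wall `a(κ₀X² + κ₁Y²) + c = (l₀ + l₁X + l₂Y)²`: the branch lies on the wall (`ConicWall.Xb_wall`), `X −
YX′ = ε(l₀Λ_ε − c)/√δ` (`ConicWall.Xb_sub`), `pheight = (γ/3)·|Λ_ε³(l₀Λ_ε − c)|/(√δ(Λ_ε² − c))`
(`ConicWall.pheight_Xb`), and the branch `ε = −1` is the branch `ε = +1` of the wall with `l₁ ↦ −l₁`
(`ConicWall.negl₁`). Main result: `InBaker.conic_height` — the `h`-input of `InBaker.psection_height`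
for a section bounded by an adapted conic wall, on the generic stratum. [KontsevichZagier2001 §1.2; this
node] -/

noncomputable section

open Set MeasureTheory Literature.NumberTheory.Transcendental
open Literature.ModelTheory.ExponentialFields (IsSemialgebraic IsSemialgebraic)

namespace Summit.KontsevichZagierPeriods.RootDecompWalshStrata.ConicDescent

namespace ConicWall

variable (W : ConicWall)

/-! #### 36.4 The branch `X_ε(Y)` of an adapted conic wall -/

/-- The wall with `l₁ ↦ −l₁` (same `k`, `L`, `P`, `δ`; its `Λ` is the conjugate branch value). -/
def negl₁ : ConicWall := ⟨W.κ₀, W.κ₁, W.a, W.c, W.l₀, -W.l₁, W.l₂⟩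

/-- Auxiliary step `negl₁_κ₀`. [bookkeeping] -/
@[simp] theorem negl₁_κ₀ : W.negl₁.κ₀ = W.κ₀ := rfl
/-- Auxiliary step `negl₁_κ₁`. [bookkeeping] -/
@[simp] theorem negl₁_κ₁ : W.negl₁.κ₁ = W.κ₁ := rfl
/-- Auxiliary step `negl₁_a`. [bookkeeping] -/
@[simp] theorem negl₁_a : W.negl₁.a = W.a := rfl
/-- Auxiliary step `negl₁_c`. [bookkeeping] -/
@[simp] theorem negl₁_c : W.negl₁.c = W.c := rfl
/-- Auxiliary step `negl₁_l₀`. [bookkeeping] -/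
@[simp] theorem negl₁_l₀ : W.negl₁.l₀ = W.l₀ := rfl
/-- Auxiliary step `negl₁_l₁`. [bookkeeping] -/
@[simp] theorem negl₁_l₁ : W.negl₁.l₁ = -W.l₁ := rfl
/-- Auxiliary step `negl₁_l₂`. [bookkeeping] -/
@[simp] theorem negl₁_l₂ : W.negl₁.l₂ = W.l₂ := rfl

/-- Auxiliary step `negl₁_k`. [bookkeeping] -/
@[simp] theorem negl₁_k : W.negl₁.k = W.k := by
  show W.a * W.κ₀ - (-W.l₁) ^ 2 = W.a * W.κ₀ - W.l₁ ^ 2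
  ring

/-- Auxiliary step `negl₁_L`. [bookkeeping] -/
@[simp] theorem negl₁_L (y : ℝ) : W.negl₁.L y = W.L y := rfl
/-- Auxiliary step `negl₁_P`. [bookkeeping] -/
@[simp] theorem negl₁_P (y : ℝ) : W.negl₁.P y = W.P y := rfl

/-- Auxiliary step `negl₁_δ`. [bookkeeping] -/
@[simp] theorem negl₁_δ (y : ℝ) : W.negl₁.δ y = W.δ y := by
  simp only [δ, negl₁_k, negl₁_L, negl₁_a, negl₁_κ₀, negl₁_κ₁, negl₁_c]

/-- Auxiliary step `negl₁_δe`. [bookkeeping] -/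
@[simp] theorem negl₁_δe : W.negl₁.δe = W.δe := by
  simp only [δe, negl₁_k, negl₁_a, negl₁_κ₀, negl₁_κ₁, negl₁_l₂]

/-- Auxiliary step `negl₁_δf`. [bookkeeping] -/
@[simp] theorem negl₁_δf : W.negl₁.δf = W.δf := rfl

/-- Auxiliary step `negl₁_δg`. [bookkeeping] -/
@[simp] theorem negl₁_δg : W.negl₁.δg = W.δg := by
  simp only [δg, negl₁_k, negl₁_a, negl₁_κ₀, negl₁_l₀, negl₁_c]

/-- Auxiliary step `negl₁_Λ`. [bookkeeping] -/
theorem negl₁_Λ (y : ℝ) : W.negl₁.Λ y = (W.P y - W.l₁ * √(W.δ y)) / W.k := by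
  simp only [Λ, negl₁_P, negl₁_δ, negl₁_k, negl₁_l₁]
  push_cast
  ring

/-- Auxiliary step `negl₁_LY`. [bookkeeping] -/
@[simp] theorem negl₁_LY : W.negl₁.LY = W.LY := rfl
/-- Auxiliary step `negl₁_PY`. [bookkeeping] -/
@[simp] theorem negl₁_PY : W.negl₁.PY = W.PY := rfl

/-- Auxiliary step `negl₁_δY`. [bookkeeping] -/
@[simp] theorem negl₁_δY : W.negl₁.δY = W.δY := by
  simp only [δY, negl₁_k, negl₁_LY, negl₁_a, negl₁_κ₀, negl₁_κ₁, negl₁_c]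

/-- Auxiliary step `negl₁_R4Y`. [bookkeeping] -/
@[simp] theorem negl₁_R4Y : W.negl₁.R4Y = W.R4Y := by
  simp only [R4Y, negl₁_PY, negl₁_δY, negl₁_k, negl₁_l₁, negl₁_c, neg_sq]

/-- The derivative `δ′(Y) = 2eY + f` of the radicand. -/
def dδ (y : ℝ) : ℝ := 2 * (W.δe : ℝ) * y + W.δf

/-- Auxiliary step `hasDerivAt_δ`. [bookkeeping] -/
theorem hasDerivAt_δ (y : ℝ) : HasDerivAt W.δ (W.dδ y) y := by
  have hf : (fun y => qD W.δe W.δf W.δg y) = W.δ := funext fun y => (W.δ_eq_qD y).symm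
  have h := hasDerivAt_qD W.δe W.δf W.δg y
  rw [hf] at h
  exact h

/-- The branch `X_ε(Y) = (l₁L(Y) + ε√δ(Y))/k` of the wall, as a graph over the height `Y`. -/
def Xb (ε : ℚ) (y : ℝ) : ℝ := (W.l₁ * W.L y + ε * √(W.δ y)) / W.k

/-- Its derivative `X_ε′(Y) = (l₁l₂ + ε·δ′/(2√δ))/k`. -/
def Xb' (ε : ℚ) (y : ℝ) : ℝ := (W.l₁ * W.l₂ + ε * (W.dδ y / (2 * √(W.δ y)))) / W.k

/-- Auxiliary step `hasDerivAt_Xb`. [bookkeeping] -/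
theorem hasDerivAt_Xb (ε : ℚ) (y : ℝ) (hδ : W.δ y ≠ 0) :
    HasDerivAt (W.Xb ε) (W.Xb' ε y) y := by
  have h1 : HasDerivAt (fun x : ℝ => (W.l₁ : ℝ) * ((W.l₀ : ℝ) + (W.l₂ : ℝ) * x))
      ((W.l₁ : ℝ) * W.l₂) y :=
    ((((hasDerivAt_id' y).const_mul (W.l₂ : ℝ)).const_add (W.l₀ : ℝ)).const_mul
      (W.l₁ : ℝ)).congr_deriv (by rw [mul_one])
  have h2 : HasDerivAt (fun x : ℝ => (ε : ℝ) * √(W.δ x)) ((ε : ℝ) * (W.dδ y / (2 * √(W.δ y)))) y :=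
    ((W.hasDerivAt_δ y).sqrt hδ).const_mul _
  exact (h1.add h2).div_const (W.k : ℝ)

/-- `X_ε` is `ℚ`-semialgebraic in the height. [BCR1998 §2.2] -/
theorem isSemialgebraicFunOn_Xb (ε : ℚ) {T : Set (Fin 1 → ℝ)} (hT : IsSemialgebraic ℚ T) :
    IsSemialgebraicFunOn ℚ T fun v => W.Xb ε (v 0) := by
  have hδ : IsSemialgebraicFunOn ℚ T fun v => W.δ (v 0) :=
    (isSemialgebraicFunOn_qD W.δe W.δf W.δg hT).congr fun v _ => by rw [W.δ_eq_qD]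
  have hL : IsSemialgebraicFunOn ℚ T fun v => W.L (v 0) :=
    ((IsRatOn.polyAeval W.LY IsRatOn.coord).isSemialgebraicFunOn hT).congr fun v _ =>
      W.aeval_LY (v 0)
  exact ((isSemialgebraicFunOn_ratCast hT (1 / W.k)).mul_holds
    (((isSemialgebraicFunOn_ratCast hT W.l₁).mul_holds hL).add_holds
      ((isSemialgebraicFunOn_ratCast hT ε).mul_holds (IsSemialgebraicFunOn.sqrt_holds hδ)))).congr
    fun v _ => by
      simp only [Pi.mul_apply, Pi.add_apply, Xb]
      push_cast
      ring

/-- `X_ε′` is `ℚ`-semialgebraic on a set where `δ > 0`. [BCR1998 §2.2] -/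
theorem isSemialgebraicFunOn_Xb' (ε : ℚ) {T : Set (Fin 1 → ℝ)} (hT : IsSemialgebraic ℚ T)
    (hpos : ∀ v ∈ T, 0 < W.δ (v 0)) :
    IsSemialgebraicFunOn ℚ T fun v => W.Xb' ε (v 0) := by
  have hδ : IsSemialgebraicFunOn ℚ T fun v => W.δ (v 0) :=
    (isSemialgebraicFunOn_qD W.δe W.δf W.δg hT).congr fun v _ => by rw [W.δ_eq_qD]
  have hd : IsSemialgebraicFunOn ℚ T fun v => W.dδ (v 0) :=
    ((IsRatOn.polyAeval (Polynomial.C (2 * W.δe) * Polynomial.X + Polynomial.C W.δf)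
      IsRatOn.coord).isSemialgebraicFunOn hT).congr fun v _ => by
      simp only [map_add, map_mul, Polynomial.aeval_C, Polynomial.aeval_X, eq_ratCast, dδ]
      push_cast
      ring
  have hq : IsSemialgebraicFunOn ℚ T fun v => W.dδ (v 0) / (2 * √(W.δ (v 0))) :=
    hd.div ((isSemialgebraicFunOn_ratCast hT 2).mul_holds (IsSemialgebraicFunOn.sqrt_holds hδ))
      fun v hv => by
        have h2 : ((2 : ℚ) : ℝ) * √(W.δ (v 0)) ≠ 0 := by
          push_cast
          exact mul_ne_zero two_ne_zero (Real.sqrt_pos.2 (hpos v hv)).ne'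
        simpa using h2
  exact ((isSemialgebraicFunOn_ratCast hT (1 / W.k)).mul_holds
    ((isSemialgebraicFunOn_ratCast hT (W.l₁ * W.l₂)).add_holds
      ((isSemialgebraicFunOn_ratCast hT ε).mul_holds hq))).congr fun v _ => by
    simp only [Pi.mul_apply, Pi.add_apply, Xb']
    push_cast
    ring

/-- **The branch lies on the wall**: `a(κ₀X_ε² + κ₁Y²) + c = Λ_ε²`, `Λ_ε = (P + εl₁√δ)/k` (the value of
`l₀ + l₁X_ε + l₂Y`). [this node] -/
theorem Xb_wall (ε : ℚ) (hε : ε = 1 ∨ ε = -1) (hk : W.k ≠ 0) (y : ℝ) (hδ : 0 ≤ W.δ y) :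
    W.a * (W.κ₀ * W.Xb ε y ^ 2 + W.κ₁ * y ^ 2) + W.c =
      ((W.P y + ε * W.l₁ * √(W.δ y)) / W.k) ^ 2 := by
  have hk0 : (W.k : ℝ) ≠ 0 := by exact_mod_cast hk
  have hε2 : (ε : ℝ) ^ 2 = 1 := by
    rcases hε with rfl | rfl
    · simp
    · simp
  set u := √(W.δ y) with hu_def
  have hu : u ^ 2 = W.a * W.κ₀ * W.L y ^ 2 - W.k * (W.a * W.κ₁ * y ^ 2 + W.c) := by
    rw [hu_def, Real.sq_sqrt hδ]
    rfl
  have hkd : (W.k : ℝ) = W.a * W.κ₀ - W.l₁ ^ 2 := by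
    simp only [k]
    push_cast
    ring
  have hX : (W.k : ℝ) * W.Xb ε y = W.l₁ * W.L y + ε * u := by
    simp only [Xb]
    rw [← hu_def]
    field_simp
  have ht : (W.k : ℝ) * ((W.P y + ε * W.l₁ * u) / W.k) = W.a * W.κ₀ * W.L y + ε * W.l₁ * u := by
    simp only [P]
    field_simp
  have key : (W.k : ℝ) ^ 2 * (W.a * (W.κ₀ * W.Xb ε y ^ 2 + W.κ₁ * y ^ 2) + W.c) =
      (W.k : ℝ) ^ 2 * ((W.P y + ε * W.l₁ * u) / W.k) ^ 2 := by
    rw [show (W.k : ℝ) ^ 2 * (W.a * (W.κ₀ * W.Xb ε y ^ 2 + W.κ₁ * y ^ 2) + W.c) =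
        W.a * (W.κ₀ * ((W.k : ℝ) * W.Xb ε y) ^ 2 + W.κ₁ * y ^ 2 * (W.k : ℝ) ^ 2) +
          W.c * (W.k : ℝ) ^ 2 by ring,
      show (W.k : ℝ) ^ 2 * ((W.P y + ε * W.l₁ * u) / W.k) ^ 2 =
        ((W.k : ℝ) * ((W.P y + ε * W.l₁ * u) / W.k)) ^ 2 by ring, hX, ht]
    linear_combination ((W.a : ℝ) * W.κ₀ * W.L y ^ 2 - (ε : ℝ) ^ 2 * u ^ 2) * hkd +
      (ε : ℝ) ^ 2 * W.k * hu +
      ((W.a : ℝ) * W.κ₀ * W.L y ^ 2 * W.k - (W.k : ℝ) ^ 2 * (W.a * W.κ₁ * y ^ 2 + W.c)) * hε2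
  exact mul_left_cancel₀ (pow_ne_zero 2 hk0) key

/-- The affine form along the branch: `l₀ + l₁X_ε + l₂Y = Λ_ε`. -/
theorem Λ_Xb (ε : ℚ) (hk : W.k ≠ 0) (y : ℝ) :
    (W.l₀ : ℝ) + W.l₁ * W.Xb ε y + W.l₂ * y = (W.P y + ε * W.l₁ * √(W.δ y)) / W.k := by
  have hk0 : (W.k : ℝ) ≠ 0 := by exact_mod_cast hk
  have hkd : (W.k : ℝ) = W.a * W.κ₀ - W.l₁ ^ 2 := by simp only [k]; push_cast; ring
  simp only [Xb, P, L]
  rw [eq_div_iff hk0, div_eq_mul_inv]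
  have hKK : (W.k : ℝ) * (W.k : ℝ)⁻¹ = 1 := mul_inv_cancel₀ hk0
  linear_combination ((W.l₀ : ℝ) + W.l₂ * y) * hkd +
    ((W.l₁ : ℝ) * (W.l₁ * (W.l₀ + W.l₂ * y) + ε * √(W.δ y))) * hKK

/-- **`X_ε − YX_ε′ = ε(l₀Λ_ε − c)/√δ`** (where `δ > 0`). [this node] -/
theorem Xb_sub (ε : ℚ) (hε : ε = 1 ∨ ε = -1) (hk : W.k ≠ 0) (y : ℝ) (hδ : 0 < W.δ y) :
    W.Xb ε y - y * W.Xb' ε y =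
      ε * (W.l₀ * ((W.P y + ε * W.l₁ * √(W.δ y)) / W.k) - W.c) / √(W.δ y) := by
  have hk0 : (W.k : ℝ) ≠ 0 := by exact_mod_cast hk
  have hE : 2 * W.δ y - y * W.dδ y = 2 * (W.a * W.κ₀ * W.l₀ * W.L y - W.k * W.c) := by
    simp only [δ, dδ, δe, δf, L, k]
    push_cast
    ring
  set u := √(W.δ y) with hu_def
  have hu0 : u ≠ 0 := by rw [hu_def]; exact (Real.sqrt_pos.2 hδ).ne'
  have hu : u ^ 2 = W.δ y := by rw [hu_def]; exact Real.sq_sqrt hδ.le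
  have h1 : W.Xb ε y - y * W.Xb' ε y =
      (2 * W.l₁ * W.l₀ * u + ε * (2 * W.δ y - y * W.dδ y)) / (2 * W.k * u) := by
    rw [← hu]
    simp only [Xb, Xb', L]
    field_simp
    ring
  rw [h1, hE]
  simp only [P]
  field_simp
  rcases hε with rfl | rfl
  · push_cast
    ring
  · push_cast
    ring

/-- `Λ_ε² − c ≠ 0` wherever `R₄ ≠ 0` (`R₄ = k⁴(Λ₊² − c)(Λ₋² − c)`). -/
theorem Λε_sq_sub_ne (ε : ℚ) (hε : ε = 1 ∨ ε = -1) (hk : W.k ≠ 0) (y : ℝ) (hδ : 0 ≤ W.δ y)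
    (hR4 : Polynomial.aeval y W.R4Y ≠ 0) :
    ((W.P y + ε * W.l₁ * √(W.δ y)) / W.k) ^ 2 - W.c ≠ 0 := by
  have hk0 : (W.k : ℝ) ≠ 0 := by exact_mod_cast hk
  intro h
  apply hR4
  rw [W.aeval_R4Y y hδ]
  have h' : (W.P y + ε * W.l₁ * √(W.δ y)) ^ 2 - W.c * W.k ^ 2 = 0 := by
    have := congrArg (fun t => t * (W.k : ℝ) ^ 2) h
    simp only [zero_mul] at this
    rw [← this]
    field_simp
  rcases hε with rfl | rfl
  · push_cast at h'
    rw [one_mul] at h'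
    rw [h', zero_mul]
  · push_cast at h'
    rw [show W.P y - (W.l₁ : ℝ) * √(W.δ y) = W.P y + -1 * W.l₁ * √(W.δ y) by ring, h', mul_zero]

/-- **THE HEIGHT INTEGRAND ON A CONIC BRANCH**: `pheight = (γ/3)·|Λ_ε³(l₀Λ_ε − c)|/(√δ(Λ_ε² − c))`.
[this node] -/
theorem pheight_Xb (γ ε : ℚ) (hε : ε = 1 ∨ ε = -1) (hk : W.k ≠ 0) (ha : W.a ≠ 0)
    (hκ : 0 ≤ W.κ₀ ∧ 0 ≤ W.κ₁) (v : Fin 1 → ℝ) (hδ : 0 < W.δ (v 0))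
    (hΛc : ((W.P (v 0) + ε * W.l₁ * √(W.δ (v 0))) / W.k) ^ 2 - W.c ≠ 0) :
    BallCube.pheight W.κ₀ W.κ₁ γ W.a W.c (W.Xb ε) (W.Xb' ε) v =
      (γ / 3 : ℝ) * |((W.P (v 0) + ε * W.l₁ * √(W.δ (v 0))) / W.k) ^ 3 *
        (W.l₀ * ((W.P (v 0) + ε * W.l₁ * √(W.δ (v 0))) / W.k) - W.c)| /
        (√(W.δ (v 0)) * (((W.P (v 0) + ε * W.l₁ * √(W.δ (v 0))) / W.k) ^ 2 - W.c)) := by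
  have ha0 : (W.a : ℝ) ≠ 0 := by exact_mod_cast ha
  have hu0 : 0 < √(W.δ (v 0)) := Real.sqrt_pos.2 hδ
  have hwall := W.Xb_wall ε hε hk (v 0) hδ.le
  have hsub := W.Xb_sub ε hε hk (v 0) hδ
  set t := (W.P (v 0) + ε * W.l₁ * √(W.δ (v 0))) / W.k with ht
  set u := √(W.δ (v 0)) with hu
  clear_value t u
  have hρ0 : 0 ≤ (W.κ₀ : ℝ) * W.Xb ε (v 0) ^ 2 + W.κ₁ * v 0 ^ 2 :=
    add_nonneg (mul_nonneg (by exact_mod_cast hκ.1) (sq_nonneg _))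
      (mul_nonneg (by exact_mod_cast hκ.2) (sq_nonneg _))
  have hρ : (W.κ₀ : ℝ) * W.Xb ε (v 0) ^ 2 + W.κ₁ * v 0 ^ 2 = (t ^ 2 - W.c) / W.a := by
    rw [eq_div_iff ha0]
    linear_combination hwall
  have hε1 : |(ε : ℝ)| = 1 := by
    rcases hε with rfl | rfl
    · simp
    · simp
  simp only [BallCube.pheight, BallCube.ph]
  rw [Real.sq_sqrt hρ0, hwall, Real.sqrt_sq_eq_abs, hsub, hρ, abs_div ((ε : ℝ) * (W.l₀ * t - W.c)) u,
    abs_mul (ε : ℝ) (W.l₀ * t - W.c), hε1, one_mul, abs_of_pos hu0, abs_mul (t ^ 3) (W.l₀ * t - W.c),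
    abs_pow t 3, show |t| ^ 3 = t ^ 2 * |t| by rw [pow_succ, sq_abs]]
  have htc : t ^ 2 - (W.c : ℝ) ≠ 0 := hΛc
  field_simp

end ConicWall

/-! #### 36.5 The conic-wall terminal of `InBaker.psection_height` -/

/-- **CONIC-WALL HEIGHT TERMINAL.** For an adapted conic wall `W` (`k ≠ 0`, `a ≠ 0`, `κ₀, κ₁ ≥ 0`) on
the generic stratum (`δ` a non-degenerate quadratic), a rational hull `[lo, hi]` on which `R₄ ≠ 0`, and
a representation whose domain lies in the hull and in `{δ > 0}` and whose integrand is the height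
integrand `pheight` along the branch `X_ε`: it is in `InBaker`. This is the `h`-input of
`InBaker.psection_height` for a section bounded by the conic wall. [KontsevichZagier2001 §1.2; this
node] -/
theorem InBaker.conic_height (W : ConicWall) (γ ε : ℚ) (hε : ε = 1 ∨ ε = -1) (hk : W.k ≠ 0)
    (ha : W.a ≠ 0) (hκ : 0 ≤ W.κ₀ ∧ 0 ≤ W.κ₁) (he : W.δe ≠ 0)
    (hh : W.δg - W.δf ^ 2 / (4 * W.δe) ≠ 0) (lo hi : ℚ)
    (hR4 : ∀ x : ℝ, (lo : ℝ) ≤ x → x ≤ hi → Polynomial.aeval x W.R4Y ≠ 0)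
    (r : KZ.IntegralRep 1) (hdom : ∀ v ∈ r.domain, (lo : ℝ) ≤ v 0 ∧ v 0 ≤ hi)
    (hδ : ∀ v ∈ r.domain, 0 < W.δ (v 0))
    (hr : EqOn r.integrand (BallCube.pheight W.κ₀ W.κ₁ γ W.a W.c (W.Xb ε) (W.Xb' ε)) r.domain) :
    InBaker (KZ.of r) := by
  have hΛc : ∀ v ∈ r.domain,
      ((W.P (v 0) + ε * W.l₁ * √(W.δ (v 0))) / W.k) ^ 2 - W.c ≠ 0 := fun v hv =>
    W.Λε_sq_sub_ne ε hε hk (v 0) (hδ v hv).le (hR4 _ (hdom v hv).1 (hdom v hv).2)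
  rcases hε with rfl | rfl
  · refine InBaker.conic_terminal_abs W γ hk he hh lo hi hR4 r hdom hδ fun v hv => ?_
    have hΛ : (W.P (v 0) + ((1 : ℚ) : ℝ) * W.l₁ * √(W.δ (v 0))) / W.k = W.Λ (v 0) := by
      simp only [ConicWall.Λ]
      push_cast
      ring
    rw [hr hv]
    beta_reduce
    rw [W.pheight_Xb γ 1 (Or.inl rfl) hk ha hκ v (hδ v hv) (hΛc v hv), hΛ]
  · have hk' : W.negl₁.k ≠ 0 := by rwa [W.negl₁_k]
    have he' : W.negl₁.δe ≠ 0 := by rwa [W.negl₁_δe]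
    have hh' : W.negl₁.δg - W.negl₁.δf ^ 2 / (4 * W.negl₁.δe) ≠ 0 := by
      rwa [W.negl₁_δg, W.negl₁_δf, W.negl₁_δe]
    refine InBaker.conic_terminal_abs W.negl₁ γ hk' he' hh' lo hi
      (fun x h₁ h₂ => by rw [W.negl₁_R4Y]; exact hR4 x h₁ h₂) r hdom
      (fun v hv => by rw [W.negl₁_δ]; exact hδ v hv) fun v hv => ?_
    have hΛ : (W.P (v 0) + ((-1 : ℚ) : ℝ) * W.l₁ * √(W.δ (v 0))) / W.k = W.negl₁.Λ (v 0) := by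
      rw [W.negl₁_Λ]
      push_cast
      ring
    rw [hr hv]
    beta_reduce
    rw [W.pheight_Xb γ (-1) (Or.inr rfl) hk ha hκ v (hδ v hv) (hΛc v hv), hΛ, W.negl₁_δ,
      W.negl₁_l₀, W.negl₁_c]

end Summit.KontsevichZagierPeriods.RootDecompWalshStrata.ConicDescent

end
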